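import Summits.KontsevichZagierPeriods.KontsevichZagierPeriods.Theorems.SoloBlindSummitSplit
import Mathlib.RingTheory.Localization.Away.Basic
import HarnessLib

/-!
# The summit statement splits as "KZ up to `π`-power torsion" ∧ "`π` cancels"

`SoloBlind.kz_iff_injective_evalQ` identifies the summit statement
`Literature.Periods.KZPeriodConjecture` with the injectivity of the period map `evalQ : Q →+* ℝ`
on the formal period ring `Q = FormalRep ⧸ relations`, and `SoloBlind.cancel_of_kz` shows that any
proof of it proves that every class of non-zero period is cancellable.

Here one class `p : Q` of non-zero period is fixed — the guiding case is `p = x_π`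
(`SoloBlind.xPi`, the class of `4 • [(0,1), 1/(1+t²)]`, `evalQ x_π = π`) — and the period map
is extended to the localisation `Q[1/p]` (`SoloBlind.evalQAway`).  The summit statement then splits
into two statements of very different nature:

* `SoloBlind.kz_iff_away` :
  `KZPeriodConjecture ↔ Injective (evalQAway hp) ∧ p ∈ nonZeroDivisors Q`;
* `SoloBlind.injective_evalQAway_iff` : injectivity of the localised period map says exactly
  **"KZ up to `p`-power torsion"**: a formal combination of representations of total period `0`
  becomes a consequence of the three rules after multiplying it enough times by a
  representative of `p` (`SoloBlind.injective_evalQAway_iff_rep`);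
* `p ∈ nonZeroDivisors Q` — **"`p` cancels"**, `(C)_p`: `x * p = 0 → x = 0` in `Q`,
  equivalently (`SoloBlind.injective_algebraMap_away_iff`) the map `Q → Q[1/p]` is injective,
  equivalently `Q` has no `p`-power torsion (`SoloBlind.mem_nonZeroDivisors_iff_no_torsion`).

So (`SoloBlind.kz_iff_awayPi`) **the Kontsevich–Zagier conjecture is equivalent to the
conjunction of (i) its torsion-free shadow "equal periods ⇒ equivalent after multiplying both
sides by a power of `[π]`" and (ii) the single cancellation law "if `R × [π]` can be moved to the
empty integral by the rules then so can `R`".**  Statement (ii) is a statement about the class of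
`π` alone; by Kontsevich's definition of the formal period algebra as the localisation of the
effective one at the Lefschetz period, it is the calculus form of the injectivity of
"effective formal periods → all formal periods".

The file also records what `(C)_p` buys structurally, with the comparison to a bigger ring kept
as an explicit hypothesis: if `Q[1/p]` is reduced (resp. has no zero-divisors) then `(C)_p` gives
`(R)` (resp. `(D)`) for `Q` (`SoloBlind.isReduced_of_mem_nonZeroDivisors`,
`SoloBlind.noZeroDivisors_iff_away`, `SoloBlind.kz_iff_nzd_domain_transcendental`), and
unconditionally any relation `x * y = 0` in `Q` whose factor `y` becomes a non-zero-divisor in a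
ring receiving `Q[1/p]` injectively forces `p ^ n * x = 0`
(`SoloBlind.exists_pow_mul_eq_zero_of_mul_eq_zero`): cancellation holds up to `p`-power
torsion, and fully under `(C)_p`.
-/

namespace Summit.KontsevichZagierPeriods.KontsevichZagierPeriods.Theorems

open Literature.NumberTheory.Transcendental
open Literature.NumberTheory.Transcendental.KZ

namespace SoloBlind

/-! ## Cancellation by one class -/

/-- `(C)_p` — **the class `p` cancels** in the formal period ring, `x * p = 0 → x = 0` — is
the statement `p ∈ nonZeroDivisors Q`; this file uses the latter as its official form. -/
theorem mem_nonZeroDivisors_iff_cancel (p : Q) :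
    p ∈ nonZeroDivisors Q ↔ ∀ x : Q, x * p = 0 → x = 0 :=
  mem_nonZeroDivisors_iff_right

/-- `(C)_p` as the absence of `p`-power torsion. -/
theorem mem_nonZeroDivisors_iff_no_torsion (p : Q) :
    p ∈ nonZeroDivisors Q ↔ ∀ (x : Q) (n : ℕ), p ^ n * x = 0 → x = 0 := by
  rw [mem_nonZeroDivisors_iff_cancel]
  refine ⟨fun h x n hx => ?_, fun h x hx => h x 1 (by rwa [pow_one, mul_comm])⟩
  have hn : p ^ n ∈ nonZeroDivisors Q := pow_mem ((mem_nonZeroDivisors_iff_cancel p).mpr h) n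
  exact (mem_nonZeroDivisors_iff_cancel _).mp hn x (by rwa [mul_comm] at hx)

/-- Any proof of the summit statement proves `(C)_p` for every class of non-zero period. -/
theorem mem_nonZeroDivisors_of_kz (h : Literature.Periods.KZPeriodConjecture) {p : Q}
    (hp : evalQ p ≠ 0) : p ∈ nonZeroDivisors Q :=
  (mem_nonZeroDivisors_iff_cancel p).mpr fun _ hx => cancel_of_kz h hp hx

/-- A class of non-zero period is itself non-zero. -/
theorem ne_zero_of_evalQ_ne_zero {p : Q} (hp : evalQ p ≠ 0) : p ≠ 0 := by
  rintro rfl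
  exact hp (map_zero evalQ)

/-! ## The localisation `Q[1/p]` and the localised period map -/

/-- The kernel of `Q → Q[1/p]` is the `p`-power torsion of `Q`. -/
theorem algebraMap_away_eq_zero_iff {p : Q} (x : Q) :
    algebraMap Q (Localization.Away p) x = 0 ↔ ∃ n : ℕ, p ^ n * x = 0 := by
  rw [IsLocalization.map_eq_zero_iff (Submonoid.powers p)]
  constructor
  · rintro ⟨⟨m, n, rfl⟩, hm⟩
    exact ⟨n, hm⟩
  · rintro ⟨n, hn⟩
    exact ⟨⟨p ^ n, n, rfl⟩, hn⟩

/-- **`(C)_p` ⟺ the localisation map `Q → Q[1/p]` is injective.** -/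
theorem injective_algebraMap_away_iff (p : Q) :
    Function.Injective (algebraMap Q (Localization.Away p)) ↔ p ∈ nonZeroDivisors Q := by
  rw [injective_iff_map_eq_zero, mem_nonZeroDivisors_iff_no_torsion]
  constructor
  · intro h x n hx
    exact h x ((algebraMap_away_eq_zero_iff x).mpr ⟨n, hx⟩)
  · intro h x hx
    obtain ⟨n, hn⟩ := (algebraMap_away_eq_zero_iff x).mp hx
    exact h x n hn

/-- **The localised period map** `Q[1/p] →+* ℝ`, for a class `p` of non-zero period. -/
noncomputable def evalQAway {p : Q} (hp : evalQ p ≠ 0) : Localization.Away p →+* ℝ :=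
  IsLocalization.Away.lift p (g := evalQ) (isUnit_iff_ne_zero.mpr hp)

/-- The localised period map extends `evalQ`. -/
@[simp] theorem evalQAway_algebraMap {p : Q} (hp : evalQ p ≠ 0) (x : Q) :
    evalQAway hp (algebraMap Q (Localization.Away p) x) = evalQ x :=
  IsLocalization.Away.lift_eq p _ x

/-- **Injectivity of the localised period map is "KZ up to `p`-power torsion"**: every class of
period `0` is killed by a power of `p`. -/
theorem injective_evalQAway_iff {p : Q} (hp : evalQ p ≠ 0) :
    Function.Injective (evalQAway hp) ↔
      ∀ x : Q, evalQ x = 0 → ∃ n : ℕ, p ^ n * x = 0 := by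
  constructor
  · intro h x hx
    rw [← algebraMap_away_eq_zero_iff]
    apply h
    rw [evalQAway_algebraMap, hx, map_zero]
  · intro h
    apply IsLocalization.injective_of_map_algebraMap_zero (M := Submonoid.powers p)
    intro x hx
    rw [evalQAway_algebraMap] at hx
    exact (algebraMap_away_eq_zero_iff x).mpr (h x hx)

/-- Multiplying `n` times by `q` in `FormalRep` is multiplication by `[q] ^ n` in `Q`. -/
theorem mkQ_iterate_mul (q : FormalRep) (n : ℕ) (z : FormalRep) :
    mkQ ((q * ·)^[n] z) = mkQ q ^ n * mkQ z := by
  induction n with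
  | zero => rw [Function.iterate_zero_apply, pow_zero, one_mul]
  | succ n ih => rw [Function.iterate_succ_apply', mkQ_mul, ih, pow_succ', mul_assoc]

/-- "KZ up to `p`-power torsion" on formal combinations: if `p = [q]`, injectivity of the
localised period map says that every formal `ℤ`-combination of representations of total period
`0` becomes a consequence of the three rules after multiplying it `n` times by `q`, for some `n`
(`FormalRep` is not associative on the nose, hence the iterate). -/
theorem injective_evalQAway_iff_rep {q : FormalRep} (hq : evalQ (mkQ q) ≠ 0) :
    Function.Injective (evalQAway hq) ↔
      ∀ z : FormalRep, eval z = 0 → ∃ n : ℕ, (q * ·)^[n] z ∈ relations := by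
  rw [injective_evalQAway_iff]
  constructor
  · intro h z hz
    obtain ⟨n, hn⟩ := h (mkQ z) (by rw [evalQ_mkQ, hz])
    exact ⟨n, mkQ_eq_zero_iff.mp (by rw [mkQ_iterate_mul, hn])⟩
  · intro h x hx
    obtain ⟨z, rfl⟩ := mkQ_surjective x
    obtain ⟨n, hn⟩ := h z (by rwa [evalQ_mkQ] at hx)
    exact ⟨n, by rw [← mkQ_iterate_mul]; exact mkQ_eq_zero_iff.mpr hn⟩

/-! ## The split of injectivity and of the summit statement -/

/-- **Injectivity of the period map ⟺ injectivity of the localised period map ∧ `(C)_p`.** -/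
theorem injective_evalQ_iff_away {p : Q} (hp : evalQ p ≠ 0) :
    Function.Injective evalQ ↔
      Function.Injective (evalQAway hp) ∧ p ∈ nonZeroDivisors Q := by
  constructor
  · intro h
    refine ⟨(injective_evalQAway_iff hp).mpr fun x hx => ⟨0, ?_⟩,
      (mem_nonZeroDivisors_iff_cancel p).mpr fun x hx => cancel_of_injective_evalQ h hp hx⟩
    rw [pow_zero, one_mul]
    exact (injective_iff_map_eq_zero evalQ).mp h x hx
  · rintro ⟨hinj, hC⟩ x y hxy
    apply (injective_algebraMap_away_iff p).mpr hC
    apply hinj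
    simpa only [evalQAway_algebraMap] using hxy

/-- **The summit statement splits: `KZPeriodConjecture ↔` (KZ up to `p`-power torsion)
`∧ (C)_p`**, for any class `p` of non-zero period. -/
theorem kz_iff_away {p : Q} (hp : evalQ p ≠ 0) :
    Literature.Periods.KZPeriodConjecture ↔
      Function.Injective (evalQAway hp) ∧ p ∈ nonZeroDivisors Q :=
  kz_iff_injective_evalQ.trans (injective_evalQ_iff_away hp)

/-- The summit statement as two statements about formal combinations: torsion-KZ for a
representative `q` of a non-zero period, and cancellation by `q`. -/
theorem kz_iff_torsion_and_cancel {q : FormalRep} (hq : evalQ (mkQ q) ≠ 0) :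
    Literature.Periods.KZPeriodConjecture ↔
      (∀ z : FormalRep, eval z = 0 → ∃ n : ℕ, (q * ·)^[n] z ∈ relations) ∧
      ∀ z : FormalRep, q * z ∈ relations → z ∈ relations := by
  rw [kz_iff_away hq, injective_evalQAway_iff_rep, mem_nonZeroDivisors_iff_cancel]
  refine and_congr_right fun _ => ⟨fun h z hz => ?_, fun h x hx => ?_⟩
  · exact mkQ_eq_zero_iff.mp
      (h (mkQ z) (by rw [mul_comm, ← mkQ_mul]; exact mkQ_eq_zero_iff.mpr hz))
  · obtain ⟨z, rfl⟩ := mkQ_surjective x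
    exact mkQ_eq_zero_iff.mpr (h z (mkQ_eq_zero_iff.mp (by rw [mkQ_mul, mul_comm]; exact hx)))

/-! ## The case `p = x_π` -/

/-- `evalQ x_π = π ≠ 0`. -/
theorem evalQ_xPi_ne_zero : evalQ xPi ≠ 0 := by
  rw [evalQ_xPi]
  exact Real.pi_ne_zero

/-- **The Kontsevich–Zagier conjecture ⟺ (KZ up to `π`-power torsion) ∧ (`π` cancels).** -/
theorem kz_iff_awayPi :
    Literature.Periods.KZPeriodConjecture ↔
      Function.Injective (evalQAway evalQ_xPi_ne_zero) ∧ xPi ∈ nonZeroDivisors Q :=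
  kz_iff_away evalQ_xPi_ne_zero

/-- KZ up to `π`-power torsion, spelled out: a class of period `0` is killed by a power of `x_π`;
this is a consequence of the summit statement. -/
theorem pi_torsion_of_kz (h : Literature.Periods.KZPeriodConjecture) (x : Q) (hx : evalQ x = 0) :
    ∃ n : ℕ, xPi ^ n * x = 0 :=
  (injective_evalQAway_iff evalQ_xPi_ne_zero).mp ((kz_iff_awayPi.mp h).1) x hx

/-- `π` cancels — `[R × (4 • [(0,1), 1/(1+t²)])] = 0 → [R] = 0` — as a consequence of the
summit statement. -/
theorem cancel_xPi_of_kz (h : Literature.Periods.KZPeriodConjecture) (x : Q) (hx : x * xPi = 0) :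
    x = 0 :=
  cancel_of_kz h evalQ_xPi_ne_zero hx

/-! ## What `(C)_p` buys, given the structure of `Q[1/p]` -/

/-- If `Q[1/p]` is reduced and `p` cancels, then `Q` is reduced: `(C)_p ⟹ (R)` granted the
reducedness of the localisation. -/
theorem isReduced_of_mem_nonZeroDivisors {p : Q} (hC : p ∈ nonZeroDivisors Q)
    [IsReduced (Localization.Away p)] : IsReduced Q :=
  isReduced_of_injective (algebraMap Q (Localization.Away p))
    ((injective_algebraMap_away_iff p).mpr hC)

/-- If `Q[1/p]` embeds in a reduced ring and `p` cancels, then `Q` is reduced. -/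
theorem isReduced_of_mem_nonZeroDivisors_of_embedding {p : Q} (hC : p ∈ nonZeroDivisors Q)
    {P : Type*} [CommRing P] [IsReduced P] (ι : Localization.Away p →+* P)
    (hι : Function.Injective ι) : IsReduced Q :=
  haveI : IsReduced (Localization.Away p) := isReduced_of_injective ι hι
  isReduced_of_mem_nonZeroDivisors hC

/-- **`(D)` for `Q` ⟺ `(C)_p` ∧ `(D)` for `Q[1/p]`**, for a class `p` of non-zero period. -/
theorem noZeroDivisors_iff_away {p : Q} (hp : evalQ p ≠ 0) :
    NoZeroDivisors Q ↔ p ∈ nonZeroDivisors Q ∧ NoZeroDivisors (Localization.Away p) := by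
  have hp0 : p ≠ 0 := ne_zero_of_evalQ_ne_zero hp
  constructor
  · intro hD
    haveI : Nontrivial Q := nontrivial_of_ne p 0 hp0
    haveI : IsDomain Q := NoZeroDivisors.to_isDomain Q
    haveI : IsDomain (Localization.Away p) := Localization.Away.isDomain hp0
    exact ⟨mem_nonZeroDivisors_of_ne_zero hp0, inferInstance⟩
  · rintro ⟨hC, hD⟩
    exact ((injective_algebraMap_away_iff p).mpr hC).noZeroDivisors _ (map_zero _) (map_mul _)

/-- **The summit statement ⟺ `(C)_p` ∧ (`Q[1/p]` has no zero-divisors) ∧ `(T)`.** -/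
theorem kz_iff_nzd_domain_transcendental {p : Q} (hp : evalQ p ≠ 0) :
    Literature.Periods.KZPeriodConjecture ↔
      p ∈ nonZeroDivisors Q ∧ NoZeroDivisors (Localization.Away p) ∧
        ∀ x : Q, Transcendental K₀ x → Transcendental K₀ (evalQ x) := by
  rw [kz_iff_noZeroDivisors_transcendental, noZeroDivisors_iff_away hp, and_assoc]

/-- The summit statement from `(C)_p`, an embedding of `Q[1/p]` into a domain, and `(T)`. -/
theorem kz_of_mem_nonZeroDivisors_of_embedding {p : Q} (hp : evalQ p ≠ 0)
    (hC : p ∈ nonZeroDivisors Q) {P : Type*} [CommRing P] [NoZeroDivisors P]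
    (ι : Localization.Away p →+* P) (hι : Function.Injective ι)
    (hT : ∀ x : Q, Transcendental K₀ x → Transcendental K₀ (evalQ x)) :
    Literature.Periods.KZPeriodConjecture :=
  (kz_iff_nzd_domain_transcendental hp).mpr
    ⟨hC, hι.noZeroDivisors _ (map_zero _) (map_mul _), hT⟩

/-! ## Cancellation up to `p`-power torsion -/

/-- **Cancellation up to `p`-power torsion.** If `x * y = 0` in `Q` and `y` becomes a
non-zero-divisor in a ring `P` receiving `Q[1/p]` injectively, then `p ^ n * x = 0` for some `n`. -/
theorem exists_pow_mul_eq_zero_of_mul_eq_zero {p : Q} {P : Type*} [CommRing P]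
    (ι : Localization.Away p →+* P) (hι : Function.Injective ι) {x y : Q} (hxy : x * y = 0)
    (hy : ι (algebraMap Q (Localization.Away p) y) ∈ nonZeroDivisors P) :
    ∃ n : ℕ, p ^ n * x = 0 := by
  rw [← algebraMap_away_eq_zero_iff]
  apply hι
  rw [map_zero]
  have h : ι (algebraMap Q (Localization.Away p) x) *
      ι (algebraMap Q (Localization.Away p) y) = 0 := by
    rw [← map_mul, ← map_mul, hxy, map_zero, map_zero]
  exact (mul_right_mem_nonZeroDivisors_eq_zero_iff hy).mp h

/-- Under `(C)_p`, the same hypothesis gives honest cancellation: `x = 0`. -/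
theorem eq_zero_of_mul_eq_zero_of_mem_nonZeroDivisors {p : Q} (hC : p ∈ nonZeroDivisors Q)
    {P : Type*} [CommRing P] (ι : Localization.Away p →+* P) (hι : Function.Injective ι)
    {x y : Q} (hxy : x * y = 0)
    (hy : ι (algebraMap Q (Localization.Away p) y) ∈ nonZeroDivisors P) : x = 0 := by
  obtain ⟨n, hn⟩ := exists_pow_mul_eq_zero_of_mul_eq_zero ι hι hxy hy
  exact (mem_nonZeroDivisors_iff_no_torsion p).mp hC x n hn

end SoloBlind

end Summit.KontsevichZagierPeriods.KontsevichZagierPeriods.Theorems
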